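import Mathlib.RingTheory.MvPolynomial.WeightedHomogeneous
import Mathlib.LinearAlgebra.Vandermonde
import Mathlib.LinearAlgebra.Matrix.NonsingularInverse
import Literature.Computability.AlgebraicComplexity.LinSubst

/-!
# Border apolarity, crux `FixedWitnessObstructionQP` — interpolation of weighted components by torus substitutes

Route `ValiantsHypothesis/BorderApolarity`, crux item `stmt-ValiantsHypothesis-5778`, line
`toric-face-debordering`, stub `stub_interp` (the INTERPOLATION step of the de-bordering of a toric
degeneration; Bürgisser 2004, Lemma 5.5(3) / Strassen's homogenisation trick, in the form the line needs).

If every monomial of `f : MvPolynomial σ ℂ` has `w`-weight `≤ N`, then for every `e` the weight-`e`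
component `wHC_w^e f` is a `ℂ`-linear combination of the `N + 1` torus substitutes
`linSubst (diagonal ((j+1)^w)) f = f(…, (j+1)^{w_i} x_i, …)`, `j = 0, …, N`.

Proof.  The torus substitution `x_i ↦ s^{w_i} x_i` is `linSubst σ ℂ (Matrix.diagonal (s ^ w))`
(tree convention `linSubst_X : linSubst A (X i) = ∑ j, A j i • X j`); on a monomial `x^d` it acts by the
scalar `∏ a_i^{d_i}` (`linSubst_diagonal_monomial`), i.e. by `s ^ weight w d`
(`coeff_linSubst_diagonal_pow`), so `P(s) := linSubst (diagonal (s^w)) f = Σ_{v ≤ N} s^v · wHC_w^v f`.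
The Vandermonde matrix at the `N + 1` distinct nodes `1, 2, …, N + 1` is invertible
(`Matrix.det_vandermonde_ne_zero_iff`), so a row `c` of its inverse satisfies
`Σ_j c_j (j+1)^v = [v = e]` for all `v ≤ N` (`exists_vandermonde_dual`), and comparing coefficients
gives `wHC_w^e f = Σ_j c_j P(j+1)` for `e ≤ N`; for `e > N` the component is `0` and `c := 0` works.
-/

open MvPolynomial
open scoped BigOperators Matrix
open Literature.Computability.AlgebraicComplexity

namespace Summit.ValiantsHypothesis.ValiantsHypothesis.Theorems.BorderApolarityFixedWitnessObstructionQP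

/-- A diagonal matrix scales each variable: `diag(a) · X i = a i • X i`. [folklore] -/
theorem linSubst_diagonal_X {σ : Type*} [Fintype σ] [DecidableEq σ] (a : σ → ℂ) (i : σ) :
    linSubst σ ℂ (Matrix.diagonal a) (X i) = a i • X i := by
  -- adapted from Literature.RepresentationTheory.GeneralLinear.OrbitLatticeProbes.linSubst_diagonal_X
  rw [linSubst_X, Finset.sum_eq_single i
    (fun j _ hj => by rw [Matrix.diagonal_apply_ne _ hj, zero_smul])
    (fun h => absurd (Finset.mem_univ i) h), Matrix.diagonal_apply_eq]

/-- A diagonal matrix scales each monomial `x^d` by the character `∏ a_i^{d_i}`. [folklore] -/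
theorem linSubst_diagonal_monomial {σ : Type*} [Fintype σ] [DecidableEq σ] (a : σ → ℂ)
    (d : σ →₀ ℕ) (r : ℂ) :
    linSubst σ ℂ (Matrix.diagonal a) (monomial d r) = (d.prod fun i k => a i ^ k) • monomial d r := by
  -- adapted from Literature.RepresentationTheory.GeneralLinear.OrbitLatticeProbes.linSubst_diagonal_monomial
  rw [monomial_eq, map_mul, linSubst_C, Finsupp.prod, Finsupp.prod, map_prod, smul_eq_C_mul,
    map_prod, ← mul_assoc, mul_comm (∏ _ ∈ _, _) (C r), mul_assoc, ← Finset.prod_mul_distrib]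
  refine congrArg (C r * ·) (Finset.prod_congr rfl fun i _ => ?_)
  rw [map_pow, linSubst_diagonal_X, smul_eq_C_mul, mul_pow, map_pow]

/-- The diagonal substitution `X i ↦ a i • X i` acts on the coefficient of `x^d` by the monomial
character `∏ a_i^{d_i}`. [folklore] -/
theorem coeff_linSubst_diagonal {σ : Type*} [Fintype σ] [DecidableEq σ] (a : σ → ℂ)
    (f : MvPolynomial σ ℂ) (d : σ →₀ ℕ) :
    coeff d (linSubst σ ℂ (Matrix.diagonal a) f) = (d.prod fun i k => a i ^ k) * coeff d f := by
  -- adapted from Literature.NumberTheory.DiophantineGeometry.GLHighestWeightFormRepProofs.coeff_linSubst_diagonal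
  conv_lhs => rw [f.as_sum, map_sum]
  rw [coeff_sum]
  simp only [linSubst_diagonal_monomial, coeff_smul, coeff_monomial, smul_eq_mul]
  rw [Finset.sum_eq_single d]
  · rw [if_pos rfl]
  · intro e' _ hne
    rw [if_neg hne, mul_zero]
  · intro he
    rw [if_pos rfl, notMem_support_iff.mp he, mul_zero]

/-- The torus substitution `x_i ↦ s^{w_i} x_i` multiplies the coefficient of `x^d` by `s^{weight w d}`,
i.e. it scales the `w`-weight-`v` component by `s^v`. [folklore] -/
theorem coeff_linSubst_diagonal_pow {σ : Type*} [Fintype σ] [DecidableEq σ] (w : σ → ℕ) (s : ℂ)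
    (f : MvPolynomial σ ℂ) (d : σ →₀ ℕ) :
    coeff d (linSubst σ ℂ (Matrix.diagonal fun i => s ^ (w i)) f) =
      s ^ (Finsupp.weight w d) * coeff d f := by
  rw [coeff_linSubst_diagonal]
  congr 1
  rw [Finsupp.weight_apply, Finsupp.prod, Finsupp.sum, ← Finset.prod_pow_eq_pow_sum]
  refine Finset.prod_congr rfl fun i _ => ?_
  rw [← pow_mul, smul_eq_mul, mul_comm]

/-- Dual (interpolation) weights at the nodes `1, 2, …, N + 1`: a row of the inverse Vandermonde
matrix, `Σ_j c_j (j+1)^v = [v = e]` for all `v ≤ N`. [folklore] -/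
theorem exists_vandermonde_dual (N : ℕ) (e : Fin (N + 1)) :
    ∃ c : Fin (N + 1) → ℂ, ∀ v : Fin (N + 1),
      ∑ j : Fin (N + 1), c j * ((((j : ℕ) : ℂ) + 1) ^ (v : ℕ)) = if v = e then 1 else 0 := by
  -- adapted from Literature.Computability.AlgebraicComplexity.DepthThreeChasmAlgebra.exists_dual_weights
  set node : Fin (N + 1) → ℂ := fun j => ((j : ℕ) : ℂ) + 1 with hnode
  have hinj : Function.Injective node := by
    intro a b hab
    simp only [hnode, add_left_inj, Nat.cast_inj] at hab
    exact Fin.ext hab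
  have hdet : (Matrix.vandermonde node).det ≠ 0 := Matrix.det_vandermonde_ne_zero_iff.2 hinj
  have hunit : IsUnit (Matrix.vandermonde node) :=
    (Matrix.isUnit_iff_isUnit_det _).2 (isUnit_iff_ne_zero.2 hdet)
  obtain ⟨c, hc⟩ := (Matrix.vecMul_surjective_iff_isUnit.2 hunit) (Pi.single e 1)
  refine ⟨c, fun v => ?_⟩
  have h2 : Matrix.vecMul c (Matrix.vandermonde node) v = (Pi.single e 1 : Fin (N + 1) → ℂ) v :=
    congrFun hc v
  rw [Matrix.vecMul, dotProduct, Pi.single_apply] at h2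
  simpa [Matrix.vandermonde_apply, hnode] using h2

/-- **Interpolation of weighted-homogeneous components by torus substitutes** (Bürgisser 2004,
Lemma 5.5(3) / Strassen's homogenisation trick).  If every monomial of `f` has `w`-weight `≤ N`, then
for every `e` the weight-`e` component `wHC_w^e f` is a `ℂ`-linear combination of the `N + 1` torus
substitutes `f(…, (j+1)^{w_i} x_i, …)`, `j = 0, …, N`: `linSubst (diagonal (s^w))` scales the weight-`v`
component by `s^v`, so `P(s) := linSubst (diagonal (s^w)) f = Σ_{v ≤ N} s^v · wHC_w^v f`, and the
Vandermonde matrix at the distinct nodes `1, …, N + 1` is invertible; for `e > N` the component is `0`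
(all coefficients `c = 0`). [folklore] -/
theorem stub_interp : ∀ (σ : Type) [Fintype σ] [DecidableEq σ] (w : σ → ℕ) (N e : ℕ) (f : MvPolynomial σ ℂ),
    (∀ d ∈ f.support, Finsupp.weight w d ≤ N) →
      ∃ c : Fin (N + 1) → ℂ,
        MvPolynomial.weightedHomogeneousComponent w e f =
          ∑ j : Fin (N + 1), c j • linSubst σ ℂ (Matrix.diagonal fun i => (((j : ℕ) : ℂ) + 1) ^ (w i)) f := by
  intro σ _ _ w N e f hN
  by_cases he : e ≤ N
  · obtain ⟨c, hc⟩ := exists_vandermonde_dual N ⟨e, Nat.lt_succ_of_le he⟩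
    refine ⟨c, ?_⟩
    ext d
    rw [coeff_weightedHomogeneousComponent, coeff_sum]
    simp only [coeff_smul, coeff_linSubst_diagonal_pow, smul_eq_mul, ← mul_assoc]
    rw [← Finset.sum_mul]
    by_cases hd : d ∈ f.support
    · have hv : Finsupp.weight w d < N + 1 := Nat.lt_succ_of_le (hN d hd)
      rw [hc ⟨Finsupp.weight w d, hv⟩]
      simp only [Fin.mk.injEq, ite_mul, one_mul, zero_mul]
    · rw [notMem_support_iff.mp hd, mul_zero, ite_self]
  · refine ⟨0, ?_⟩
    rw [weightedHomogeneousComponent_eq_zero']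
    · simp
    · intro d hd h
      exact he (h ▸ hN d hd)

end Summit.ValiantsHypothesis.ValiantsHypothesis.Theorems.BorderApolarityFixedWitnessObstructionQP
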